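import Summits.QuantumFields.BalabanUV.Beta.EriceFlowEnclosureB12AsPrintedHistoryContagionShiftFlowRepinTail

/-!
# Beta / EriceFlowEnclosureB12AsPrintedHistoryContagionShiftFlowRepinScales — ASYMPTOTIC FREEDOM IS CONTAGIOUS, part 29: THE SET OF WELL-POSED SCALES ALONG A TRAJECTORY —
# CO-FINITE ALWAYS (part 25), UPWARD CLOSED FOR MARKOV FUNCTIONALS, NOT MONOTONE WITH MEMORY.  Along a box solution t of a flow with memory call the physical scale n
# WELL POSED when the flow re-pinned at the running value t(n) has the tail `t(n + ·)` as its ONLY box solution.  Part 25: for every asymptotically free t the well-posed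
# scales contain a final segment `[n₀, ∞[` (`eventually_wellPosed_tail`), and under smallness of the reference scale n₀ = 0.  THIS PART: (§44) for a MARKOV functional
# `B u = φ(u 0)` the well-posed scales are UPWARD CLOSED — a competitor from t(n+1) prepends to a competitor from t(n), the one memory term at scale n reading only t(n+1)
# (`markov_wellPosed_succ`, no smallness, no profile); (§45) WITH ONE SCALE OF MEMORY THIS FAILS: a kernel witness (node U2's `Sharpness.tent` BY NAME, re-centred:
# `B u = 2 + tent(3u₀ − ½) − tent(3u₁ − ½)`, lag-one memory, values in [1, 3], profile (60∕θ, θ) for every 0 < θ < 1 on every box) with an ASYMPTOTICALLY FREE box solution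
# `t(m) = (4 + 2m)^{−½}` from the pin ½ (profile scale ½, rate 2, WITH EQUALITY) such that **scale 0 is well posed — EVERY box solution from ½ is t — while scale 1 is NOT: from
# t(1) = 6^{−½} the flow has the second box solution `(6^{−½}, ⅓, 11^{−½}, 13^{−½}, …)`** (`wellPosed_not_monotone`); by part 25 the same trajectory is well posed again from
# some scale on (`wellPosed_zero_not_one_eventually`).  So for flows with memory the well-posed scales of an AF trajectory are co-finite but in general NOT an interval: the
# «maximal pin interval of well-posedness» of gen 37's census is the wrong object beyond the Markov class.  The mechanism: EVERY solution from ½ obeys the invariant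
# `1∕h(m)² + tent(3h(m+1) − ½) = 4 + 2m`, which confines the levels `1∕h(m)²` to `[3 + 2m, 4 + 2m]` and lets only m = 3 meet the tent's window `](20∕7)², (60∕19)²[` — where the
# next level would have to meet it too; from t(1) the levels start at 6 and the window IS met at the first step.
# (β-flow team, prover 1, unit `b2b-balaban-beta-bflow-p1`, gen 38; ROW AP-I·Uc × NODE U2 — structure of the well-posed scales)

HONEST FRAMING (page 1 of everything the β sub-cell writes): discharging `BetaPertH` makes Bałaban's UV stability UNCONDITIONAL — a
real constructive-QFT result; it is NOT the continuum limit and NOT the Clay problem.  HONEST DEPENDENCY (cell reorg 2026-08-19,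
verbatim): «continuum YM on T⁴ ⇐ BetaPertH ∧ nine spine estimates (0/9 proved); BetaPertH ⇐ (D1) ∧ (D4) ∧ CAP+tail; G-an2-4 gates
asym, D1 and NE2/3/4.»  THIS MODULE DISCHARGES NOTHING: [folklore] one prepending identity and a kernel witness (elementary arithmetic of the levels `1∕h(m)²`) over node U2's
HYPOTHESIS SHAPES `T4BetaStationary.{SeqBox, MemoryProfile}`, `T4BetaFlowWellPosed.{MemFlow, solution, iterate}`; the toy functional is OURS (built from node U2's
`Sharpness.tent`, def-free), NOT Bałaban's β ([I] = T. Bałaban, Commun. Math. Phys. **109** (1987) [Balaban1987RG1] prints no such object; which monotonicity ∕ memory structure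
Bałaban's limit functional has is NOT PRINTED — GAPS G-t4-U2-1 ∕ -2 — and not asserted; the AF profile shape is that of (0.31)'s lower half, Theorem 2 p. 259, STATED WITHOUT
PROOF).  Node U2's `tent ∕ tent_half ∕ tent_eq_zero_of_le ∕ tent_eq_zero_of_ge ∕ abs_tent_sub_tent_le ∕ tent_mem_Icc ∕ one_div_sqrt_one_div_sq ∕ one_div_sq_one_div_sqrt ∕ one_div_sqrt_le ∕ one_div_sqrt_pos`,
d4-p2's `memFlow_tail` and part 25's `eventually_wellPosed_tail` are USED BY NAME; nothing of theirs is restated or modified.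

WHAT THIS FILE PROVES (0 sorry, 0 def): §44 **`markov_wellPosed_succ`**, `markov_wellPosed_of_le`; §45 `tau_eq_zero_of_le`, `tau_eq_zero_of_ge`, `tau_third`, `tau_window`,
`tau_nonneg`, `tau_le_one`, `memoryProfile_lagOneTent`, `le_invSqrt_of`, `tau_invSqrt_eq_zero`, `seqBox_slow`, `tau_slow_succ`,
`memFlow_slow`, `slow_profile`, `fast_zero`, `fast_succ`, `seqBox_fast`, `memFlow_fast`, `fast_ne_tail`, **`unique_from_half`**, **`wellPosed_not_monotone`**, **`wellPosed_zero_not_one_eventually`**.  NOT CLAIMED: anything about Bałaban's β; that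
the well-posed scales of Bałaban's flow fail to be an interval; `BetaPertH`; Clay.
-/

namespace Summit.QuantumFields.BalabanUV.Beta.EriceFlowEnclosureB12AsPrintedHistoryContagionShiftFlowRepinScales

open Finset Filter Topology
open Literature.MathematicalPhysics.QuantumFieldTheory.Balaban1983to89
open Literature.MathematicalPhysics.QuantumFieldTheory.Balaban1983to89.T4BetaStationary (SeqBox MemoryProfile summable_profile)
open Literature.MathematicalPhysics.QuantumFieldTheory.Balaban1983to89.T4BetaFlowWellPosed (MemFlow iterate solution seqBox_shift one_div_sqrt_one_div_sq
  one_div_sq_one_div_sqrt one_div_sqrt_le)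
open Literature.MathematicalPhysics.QuantumFieldTheory.Balaban1983to89.T4BetaFlowWellPosed.Sharpness (tent tent_half tent_eq_zero_of_le tent_eq_zero_of_ge
  abs_tent_sub_tent_le tent_mem_Icc one_div_sqrt_pos)
open Summit.QuantumFields.BalabanUV.Beta.EriceRemainderEnclosureHistoryAutonomyOrder (memFlow_tail)
open Summit.QuantumFields.BalabanUV.Beta.EriceFlowEnclosureB12AsPrintedHistoryContagionShiftFlowRepinTail (eventually_wellPosed_tail)

noncomputable section

/-! ## §44 Markov functionals: the well-posed scales along a trajectory are upward closed -/

/-- **FOR A MARKOV FUNCTIONAL THE WELL-POSED SCALES ARE UPWARD CLOSED.**  `B u = φ(u 0)` (no memory); a box solution t of `MemFlow B g t` (any box γ, any pin, NO profile,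
NO smallness).  If at scale n the tail `t(n + ·)` is the ONLY box solution from the pin t(n), then at scale n + 1 the tail `t(n + 1 + ·)` is the only box solution from
t(n + 1): a competitor h from t(n+1) PREPENDS to the competitor `(t(n), h(0), h(1), …)` from t(n), because the scale-n memory term `φ(h(0)) = φ(t(n+1))` reads only the pin.
(With one scale of memory the prepended history need not solve the scale-n equation — §45.) [folklore] -/
theorem markov_wellPosed_succ {φ : ℝ → ℝ} {γ g : ℝ} {t : ℕ → ℝ} (hts : SeqBox γ t) (htf : MemFlow (fun u => φ (u 0)) g t) (n : ℕ)
    (huniq : ∀ h : ℕ → ℝ, SeqBox γ h → MemFlow (fun u => φ (u 0)) (t n) h → h = fun j => t (n + j)) :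
    ∀ h : ℕ → ℝ, SeqBox γ h → MemFlow (fun u => φ (u 0)) (t (n + 1)) h → h = fun j => t (n + 1 + j) := by
  intro h hh hf
  -- the prepended history
  set h'' : ℕ → ℝ := fun j => if j = 0 then t n else h (j - 1) with hh''
  have h0 : h'' 0 = t n := by simp [hh'']
  have hs : ∀ j, h'' (j + 1) = h j := fun j => by simp [hh'']
  have hbox : SeqBox γ h'' := by
    intro j
    rcases j with _ | j
    · rw [h0]; exact hts n
    · rw [hs]; exact hh j
  have hflow : MemFlow (fun u => φ (u 0)) (t n) h'' := by
    refine ⟨h0, fun m => ?_⟩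
    rcases m with _ | m
    · -- scale 0: `1∕h(0)² = 1∕t(n)² + φ(h(0))`, h(0) = t(n+1), from t's own equation at scale n
      show 1 / h'' (0 + 1) ^ 2 = 1 / h'' 0 ^ 2 + φ (h'' (0 + 1 + 0))
      rw [show 0 + 1 + 0 = 0 + 1 from rfl, hs 0, h0, hf.1]
      have e := htf.2 n
      simp only [add_zero] at e
      exact e
    · -- scale m+1: h's equation at scale m
      show 1 / h'' (m + 1 + 1) ^ 2 = 1 / h'' (m + 1) ^ 2 + φ (h'' (m + 1 + 1 + 0))
      rw [show m + 1 + 1 + 0 = (m + 1) + 1 from rfl, hs (m + 1), hs m]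
      have e := hf.2 m
      simp only [add_zero] at e
      exact e
  have heq := huniq h'' hbox hflow
  funext j
  have hj := congr_fun heq (j + 1)
  rw [hs j] at hj
  rw [hj]
  show t (n + (j + 1)) = t (n + 1 + j)
  rw [show n + (j + 1) = n + 1 + j by omega]

/-- … hence well posed at n ⟹ well posed at every n′ ≥ n (Markov). [folklore] -/
theorem markov_wellPosed_of_le {φ : ℝ → ℝ} {γ g : ℝ} {t : ℕ → ℝ} (hts : SeqBox γ t) (htf : MemFlow (fun u => φ (u 0)) g t) {n n' : ℕ} (hnn' : n ≤ n')
    (huniq : ∀ h : ℕ → ℝ, SeqBox γ h → MemFlow (fun u => φ (u 0)) (t n) h → h = fun j => t (n + j)) :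
    ∀ h : ℕ → ℝ, SeqBox γ h → MemFlow (fun u => φ (u 0)) (t n') h → h = fun j => t (n' + j) := by
  induction hnn' with
  | refl => exact huniq
  | step _ ih => exact markov_wellPosed_succ hts htf _ ih

/-! ## §45 One scale of memory: scale 0 well posed, scale 1 not — a kernel witness -/

/-- The re-centred tent `τ(x) = tent(3x − ½)` (peak 1 at x = ⅓, slope 60, support [19∕60, 21∕60]) vanishes below 19∕60. [folklore] -/
theorem tau_eq_zero_of_le {x : ℝ} (hx : x ≤ 19 / 60) : tent (3 * x - 1 / 2) = 0 := tent_eq_zero_of_le (by linarith)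

/-- … and above 7∕20. [folklore] -/
theorem tau_eq_zero_of_ge {x : ℝ} (hx : 7 / 20 ≤ x) : tent (3 * x - 1 / 2) = 0 := tent_eq_zero_of_ge (by linarith)

/-- … and equals 1 at ⅓. [folklore] -/
theorem tau_third : tent (3 * (1 / 3) - 1 / 2) = 1 := by
  rw [show (3 : ℝ) * (1 / 3) - 1 / 2 = 1 / 2 by norm_num]; exact tent_half

/-- THE WINDOW: `τ(x) ≠ 0` forces `19∕60 < x < 7∕20`. [folklore] -/
theorem tau_window {x : ℝ} (hx : tent (3 * x - 1 / 2) ≠ 0) : 19 / 60 < x ∧ x < 7 / 20 :=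
  ⟨lt_of_not_ge fun h => hx (tau_eq_zero_of_le h), lt_of_not_ge fun h => hx (tau_eq_zero_of_ge h)⟩

/-- `0 ≤ τ`. [folklore] -/
theorem tau_nonneg (x : ℝ) : 0 ≤ tent (3 * x - 1 / 2) := (tent_mem_Icc _).1

/-- `τ ≤ 1`. [folklore] -/
theorem tau_le_one (x : ℝ) : tent (3 * x - 1 / 2) ≤ 1 := (tent_mem_Icc _).2

/-- **THE WITNESS FUNCTIONAL HAS A MEMORY PROFILE** `(60∕θ, θ)` on every box, for every 0 < θ < 1: `B u = 2 + τ(u 0) − τ(u 1)` is 60-Lipschitz in each of its two arguments.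
[folklore] -/
theorem memoryProfile_lagOneTent {θ γ : ℝ} (hθ0 : 0 < θ) (hθ1 : θ < 1) :
    MemoryProfile (60 / θ) θ γ (fun u => 2 + tent (3 * u 0 - 1 / 2) - tent (3 * u 1 - 1 / 2)) := by
  intro u u' hu hu'
  have hs := summable_profile hθ0.le hθ1 hu hu'
  have h2 : ∑ j ∈ range 2, θ ^ j * |u j - u' j| ≤ ∑' j, θ ^ j * |u j - u' j| :=
    hs.sum_le_tsum (range 2) (fun j _ => mul_nonneg (pow_nonneg hθ0.le j) (abs_nonneg _))
  rw [Finset.sum_range_succ, Finset.sum_range_one, pow_zero, one_mul, pow_one] at h2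
  have ha := abs_tent_sub_tent_le (3 * u 0 - 1 / 2) (3 * u' 0 - 1 / 2)
  have hb := abs_tent_sub_tent_le (3 * u 1 - 1 / 2) (3 * u' 1 - 1 / 2)
  rw [show (3 * u 0 - 1 / 2) - (3 * u' 0 - 1 / 2) = 3 * (u 0 - u' 0) by ring, abs_mul, abs_of_pos (by norm_num : (0 : ℝ) < 3)] at ha
  rw [show (3 * u 1 - 1 / 2) - (3 * u' 1 - 1 / 2) = 3 * (u 1 - u' 1) by ring, abs_mul, abs_of_pos (by norm_num : (0 : ℝ) < 3)] at hb
  have hθ1' : θ ≤ 1 := hθ1.le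
  have h0 : 0 ≤ |u 0 - u' 0| := abs_nonneg _
  have h1 : 0 ≤ |u 1 - u' 1| := abs_nonneg _
  calc |2 + tent (3 * u 0 - 1 / 2) - tent (3 * u 1 - 1 / 2) - (2 + tent (3 * u' 0 - 1 / 2) - tent (3 * u' 1 - 1 / 2))|
      = |(tent (3 * u 0 - 1 / 2) - tent (3 * u' 0 - 1 / 2)) - (tent (3 * u 1 - 1 / 2) - tent (3 * u' 1 - 1 / 2))| := by ring_nf
    _ ≤ |tent (3 * u 0 - 1 / 2) - tent (3 * u' 0 - 1 / 2)| + |tent (3 * u 1 - 1 / 2) - tent (3 * u' 1 - 1 / 2)| := abs_sub _ _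
    _ ≤ 60 * |u 0 - u' 0| + 60 * |u 1 - u' 1| := by linarith
    _ ≤ 60 / θ * (|u 0 - u' 0| + θ * |u 1 - u' 1|) := by
        rw [div_mul_eq_mul_div, le_div_iff₀ hθ0]
        nlinarith [mul_le_mul_of_nonneg_right hθ1' h0, mul_nonneg hθ0.le h1]
    _ ≤ 60 / θ * ∑' j, θ ^ j * |u j - u' j| := mul_le_mul_of_nonneg_left h2 (by positivity)

/-- `y ≤ 1∕c²`, c > 0, y > 0 ⟹ `c ≤ 1∕√y`. [folklore] -/
theorem le_invSqrt_of {y c : ℝ} (hc : 0 < c) (hy : 0 < y) (h : y ≤ 1 / c ^ 2) : c ≤ 1 / Real.sqrt y := by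
  rw [le_one_div hc (Real.sqrt_pos.mpr hy)]
  have h2 := Real.sqrt_le_sqrt h
  rwa [show 1 / c ^ 2 = (1 / c) ^ 2 by ring, Real.sqrt_sq (by positivity)] at h2

/-- THE TENT MISSES EVERY LEVEL `≤ 8` AND EVERY LEVEL `≥ 10`: `τ(1∕√y) = 0` for `0 < y ≤ 8` (then `1∕√y ≥ 7∕20`, as `8 ≤ (20∕7)²`) and for `y ≥ 10` (then `1∕√y ≤ 19∕60`, as
`(60∕19)² ≤ 10`). [folklore] -/
theorem tau_invSqrt_eq_zero {y : ℝ} (hy : 0 < y) (h : y ≤ 8 ∨ 10 ≤ y) : tent (3 * (1 / Real.sqrt y) - 1 / 2) = 0 := by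
  rcases h with h | h
  · refine tau_eq_zero_of_ge (le_invSqrt_of (by norm_num) hy ?_)
    rw [show (1 : ℝ) / (7 / 20) ^ 2 = 400 / 49 by norm_num]
    linarith
  · refine tau_eq_zero_of_le (one_div_sqrt_le (by norm_num) ?_)
    rw [show (1 : ℝ) / (19 / 60) ^ 2 = 3600 / 361 by norm_num]
    linarith

/-- The slow trajectory `t(m) = (4 + 2m)^{−½}` is box-valued in ]0, ½]. [folklore] -/
theorem seqBox_slow : SeqBox (1 / 2) (fun m : ℕ => 1 / Real.sqrt (4 + 2 * (m : ℝ))) := fun m => by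
  have hm : (0 : ℝ) ≤ m := Nat.cast_nonneg m
  refine ⟨one_div_sqrt_pos (by positivity), one_div_sqrt_le (by norm_num) ?_⟩
  rw [show (1 : ℝ) / (1 / 2) ^ 2 = 4 by norm_num]
  linarith

/-- The tent vanishes along the slow trajectory from the first scale on: `τ(t(m+1)) = 0` (levels 6 + 2m ∈ {6, 8} ∪ [10, ∞[). [folklore] -/
theorem tau_slow_succ (m : ℕ) : tent (3 * (1 / Real.sqrt (4 + 2 * ((m : ℝ) + 1))) - 1 / 2) = 0 := by
  have hm : (0 : ℝ) ≤ m := Nat.cast_nonneg m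
  rcases Nat.lt_or_ge m 2 with h | h
  · interval_cases m
    · exact tau_invSqrt_eq_zero (by norm_num) (Or.inl (by norm_num))
    · exact tau_invSqrt_eq_zero (by norm_num) (Or.inl (by norm_num))
  · have h2 : (2 : ℝ) ≤ m := by exact_mod_cast h
    exact tau_invSqrt_eq_zero (by positivity) (Or.inr (by linarith))

/-- **THE SLOW TRAJECTORY SOLVES THE WITNESS FLOW FROM ½**: `1∕t(m+1)² − 1∕t(m)² = 2 = 2 + τ(t(m+1)) − τ(t(m+2))`, both tent terms vanishing (levels 6 + 2m, 8 + 2m ≠ 9).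
[folklore] -/
theorem memFlow_slow : MemFlow (fun u => 2 + tent (3 * u 0 - 1 / 2) - tent (3 * u 1 - 1 / 2)) (1 / 2) (fun m : ℕ => 1 / Real.sqrt (4 + 2 * (m : ℝ))) := by
  refine ⟨?_, fun m => ?_⟩
  · show 1 / Real.sqrt (4 + 2 * ((0 : ℕ) : ℝ)) = 1 / 2
    rw [Nat.cast_zero, mul_zero, add_zero, show (4 : ℝ) = 2 ^ 2 by norm_num, Real.sqrt_sq (by norm_num)]
  · show 1 / (1 / Real.sqrt (4 + 2 * ((m + 1 : ℕ) : ℝ))) ^ 2 = 1 / (1 / Real.sqrt (4 + 2 * (m : ℝ))) ^ 2 +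
      (2 + tent (3 * (1 / Real.sqrt (4 + 2 * ((m + 1 + 0 : ℕ) : ℝ))) - 1 / 2) - tent (3 * (1 / Real.sqrt (4 + 2 * ((m + 1 + 1 : ℕ) : ℝ))) - 1 / 2))
    have hm : (0 : ℝ) ≤ m := Nat.cast_nonneg m
    have h1 := tau_slow_succ m
    have h2 := tau_slow_succ (m + 1)
    push_cast at h1 h2 ⊢
    rw [one_div_sq_one_div_sqrt (by positivity), one_div_sq_one_div_sqrt (by positivity), show (m : ℝ) + 1 + 0 = m + 1 by ring, h1, h2]
    ring

/-- THE SLOW TRAJECTORY IS ASYMPTOTICALLY FREE with scale ½ and rate 2 — with equality: `1∕(½)² + 2m = 1∕t(m)²`. [folklore] -/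
theorem slow_profile : ∀ m : ℕ, 1 / (1 / 2 : ℝ) ^ 2 + 2 * (m : ℝ) ≤ 1 / ((fun m : ℕ => 1 / Real.sqrt (4 + 2 * (m : ℝ))) m) ^ 2 := fun m => by
  have hm : (0 : ℝ) ≤ m := Nat.cast_nonneg m
  show 1 / (1 / 2 : ℝ) ^ 2 + 2 * (m : ℝ) ≤ 1 / (1 / Real.sqrt (4 + 2 * (m : ℝ))) ^ 2
  rw [one_div_sq_one_div_sqrt (by positivity)]
  norm_num

/-- The fast history from `6^{−½}`: levels 6, then 7 + 2m (m ≥ 1): `(6^{−½}, ⅓, 11^{−½}, 13^{−½}, …)`.  Its value at 0. [folklore] -/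
theorem fast_zero : (fun m : ℕ => 1 / Real.sqrt (if m = 0 then 6 else 7 + 2 * (m : ℝ))) 0 = 1 / Real.sqrt 6 := by simp

/-- … and at m + 1: `(7 + 2(m+1))^{−½}`. [folklore] -/
theorem fast_succ (m : ℕ) : (fun m : ℕ => 1 / Real.sqrt (if m = 0 then 6 else 7 + 2 * (m : ℝ))) (m + 1) = 1 / Real.sqrt (7 + 2 * ((m : ℝ) + 1)) := by
  show 1 / Real.sqrt (if m + 1 = 0 then 6 else 7 + 2 * ((m + 1 : ℕ) : ℝ)) = 1 / Real.sqrt (7 + 2 * ((m : ℝ) + 1))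
  rw [if_neg (Nat.succ_ne_zero m)]
  push_cast
  rfl

/-- The fast history is box-valued in ]0, ½]. [folklore] -/
theorem seqBox_fast : SeqBox (1 / 2) (fun m : ℕ => 1 / Real.sqrt (if m = 0 then 6 else 7 + 2 * (m : ℝ))) := fun m => by
  rcases m with _ | m
  · rw [fast_zero]
    exact ⟨one_div_sqrt_pos (by norm_num), one_div_sqrt_le (by norm_num) (by norm_num)⟩
  · rw [fast_succ]
    have hm : (0 : ℝ) ≤ m := Nat.cast_nonneg m
    refine ⟨one_div_sqrt_pos (by positivity), one_div_sqrt_le (by norm_num) ?_⟩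
    rw [show (1 : ℝ) / (1 / 2) ^ 2 = 4 by norm_num]
    linarith

/-- **THE FAST HISTORY SOLVES THE WITNESS FLOW FROM `6^{−½}`**: scale 0 reads `9 = 6 + 2 + τ(⅓) − τ(11^{−½}) = 8 + 1 − 0`, every later step `2 = 2 + 0 − 0` (levels ≥ 11 miss the
tent). [folklore] -/
theorem memFlow_fast : MemFlow (fun u => 2 + tent (3 * u 0 - 1 / 2) - tent (3 * u 1 - 1 / 2)) (1 / Real.sqrt 6)
    (fun m : ℕ => 1 / Real.sqrt (if m = 0 then 6 else 7 + 2 * (m : ℝ))) := by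
  refine ⟨fast_zero, fun m => ?_⟩
  show 1 / ((fun m : ℕ => 1 / Real.sqrt (if m = 0 then 6 else 7 + 2 * (m : ℝ))) (m + 1)) ^ 2 =
    1 / ((fun m : ℕ => 1 / Real.sqrt (if m = 0 then 6 else 7 + 2 * (m : ℝ))) m) ^ 2 +
      (2 + tent (3 * (fun m : ℕ => 1 / Real.sqrt (if m = 0 then 6 else 7 + 2 * (m : ℝ))) (m + 1 + 0) - 1 / 2) -
        tent (3 * (fun m : ℕ => 1 / Real.sqrt (if m = 0 then 6 else 7 + 2 * (m : ℝ))) (m + 1 + 1) - 1 / 2))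
  rw [show m + 1 + 0 = m + 1 from rfl, fast_succ m, fast_succ (m + 1)]
  rcases m with _ | m
  · -- scale 0
    rw [fast_zero, one_div_sq_one_div_sqrt (by norm_num), one_div_sq_one_div_sqrt (by norm_num)]
    push_cast
    have h9 : 1 / Real.sqrt (7 + 2 * ((0 : ℝ) + 1)) = 1 / 3 := by
      rw [show (7 : ℝ) + 2 * (0 + 1) = 3 ^ 2 by norm_num, Real.sqrt_sq (by norm_num)]
    rw [h9, tau_third, tau_invSqrt_eq_zero (by norm_num) (Or.inr (by norm_num))]
    norm_num
  · -- scale m + 1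
    have hm : (0 : ℝ) ≤ m := Nat.cast_nonneg m
    rw [fast_succ m, one_div_sq_one_div_sqrt (by positivity), one_div_sq_one_div_sqrt (by positivity)]
    push_cast
    rw [tau_invSqrt_eq_zero (by positivity) (Or.inr (by linarith)), tau_invSqrt_eq_zero (by positivity) (Or.inr (by linarith))]
    ring

/-- The fast history is NOT the tail of the slow trajectory from scale 1 (levels 9 ≠ 8 at the first step). [folklore] -/
theorem fast_ne_tail : (fun m : ℕ => 1 / Real.sqrt (if m = 0 then 6 else 7 + 2 * (m : ℝ))) ≠ fun j => 1 / Real.sqrt (4 + 2 * (((1 + j : ℕ) : ℝ))) := by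
  intro h
  have h1 : (fun m : ℕ => 1 / Real.sqrt (if m = 0 then 6 else 7 + 2 * (m : ℝ))) (0 + 1) = (fun j : ℕ => 1 / Real.sqrt (4 + 2 * (((1 + j : ℕ) : ℝ)))) (0 + 1) := by
    rw [h]
  rw [fast_succ 0] at h1
  have e : 1 / (1 / Real.sqrt (7 + 2 * (((0 : ℕ) : ℝ) + 1))) ^ 2
      = 1 / ((fun j : ℕ => 1 / Real.sqrt (4 + 2 * (((1 + j : ℕ) : ℝ)))) (0 + 1)) ^ 2 := by rw [h1]
  have hpos : (0 : ℝ) < 4 + 2 * (((1 + (0 + 1) : ℕ) : ℝ)) := by positivity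
  have e' : 1 / (1 / Real.sqrt (7 + 2 * (((0 : ℕ) : ℝ) + 1))) ^ 2 = 1 / (1 / Real.sqrt (4 + 2 * (((1 + (0 + 1) : ℕ) : ℝ)))) ^ 2 := e
  rw [one_div_sq_one_div_sqrt (by positivity), one_div_sq_one_div_sqrt hpos] at e'
  push_cast at e'
  norm_num at e'

/-- **SCALE 0 IS WELL POSED: EVERY BOX SOLUTION OF THE WITNESS FLOW FROM ½ IS THE SLOW TRAJECTORY** (any box γ).  The invariant `1∕h(m)² + τ(h(m+1)) = 4 + 2m + τ(h(1))` telescopes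
from the flow; `τ(h(1)) = 0` since the level `1∕h(1)² ≤ 7` is below the window `](20∕7)², (60∕19)²[`; so `1∕h(m)² ∈ [3 + 2m, 4 + 2m]`, and a non-vanishing `τ(h(m))` (m ≥ 1) would
need that interval to meet the window — only m = 3 — and then `τ(h(4)) > 0`, putting the level `1∕h(4)² ≥ 11` inside the window: absurd.  Hence every tent term vanishes,
`1∕h(m)² = 4 + 2m`, `h = t`. [folklore] -/
theorem unique_from_half {γ : ℝ} {h : ℕ → ℝ} (hh : SeqBox γ h)
    (hf : MemFlow (fun u => 2 + tent (3 * u 0 - 1 / 2) - tent (3 * u 1 - 1 / 2)) (1 / 2) h) :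
    h = fun m : ℕ => 1 / Real.sqrt (4 + 2 * (m : ℝ)) := by
  have hpos : ∀ m, 0 < h m := fun m => (hh m).1
  -- the flow in levels
  have hrec : ∀ m, 1 / h (m + 1) ^ 2 = 1 / h m ^ 2 + (2 + tent (3 * h (m + 1) - 1 / 2) - tent (3 * h (m + 2) - 1 / 2)) := by
    intro m
    have e := hf.2 m
    simp only [add_zero] at e
    exact e
  have hy0 : 1 / h 0 ^ 2 = 4 := by rw [hf.1]; norm_num
  -- the invariant
  have hz : ∀ m : ℕ, 1 / h m ^ 2 + tent (3 * h (m + 1) - 1 / 2) = 4 + 2 * (m : ℝ) + tent (3 * h 1 - 1 / 2) := by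
    intro m
    induction m with
    | zero => rw [hy0]; simp
    | succ m ih => rw [hrec m]; push_cast; linarith
  -- the window in levels: τ(h m) ≠ 0 ⟹ (20∕7)² < 1∕h(m)² < (60∕19)²
  have hwin : ∀ m, tent (3 * h m - 1 / 2) ≠ 0 → (400 / 49 : ℝ) < 1 / h m ^ 2 ∧ 1 / h m ^ 2 < 3600 / 361 := by
    intro m hm
    obtain ⟨hl, hu⟩ := tau_window hm
    have hp := hpos m
    constructor
    · rw [show (400 / 49 : ℝ) = 1 / (7 / 20) ^ 2 by norm_num]
      exact one_div_lt_one_div_of_lt (pow_pos hp 2) (by nlinarith)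
    · rw [show (3600 / 361 : ℝ) = 1 / (19 / 60) ^ 2 by norm_num]
      exact one_div_lt_one_div_of_lt (by positivity) (by nlinarith)
  -- τ(h 1) = 0: the level 1∕h(1)² = 6 + τ(h 1) − τ(h 2) ≤ 7 is below the window
  have hτ1 : tent (3 * h 1 - 1 / 2) = 0 := by
    by_contra hne
    have hlow := (hwin 1 hne).1
    have e := hrec 0
    rw [hy0] at e
    have := tau_le_one (h 1)
    have := tau_nonneg (h 2)
    linarith
  -- the levels lie in [3 + 2m, 4 + 2m]
  have hlev : ∀ m : ℕ, 1 / h m ^ 2 = 4 + 2 * (m : ℝ) - tent (3 * h (m + 1) - 1 / 2) := fun m => by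
    have := hz m; rw [hτ1] at this; linarith
  -- every tent term vanishes
  have hτ : ∀ m, 1 ≤ m → tent (3 * h m - 1 / 2) = 0 := by
    intro m hm
    by_contra hne
    obtain ⟨hlo, hhi⟩ := hwin m hne
    have hl := hlev m
    have ht0 := tau_nonneg (h (m + 1))
    have ht1 := tau_le_one (h (m + 1))
    -- m = 3
    have hm3 : m = 3 := by
      have h1 : (2 : ℝ) < m := by linarith
      have h2 : (m : ℝ) < 4 := by linarith
      have h1' : 2 < m := by exact_mod_cast h1
      have h2' : m < 4 := by exact_mod_cast h2
      omega
    subst hm3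
    -- then τ(h 4) > 0, so the level 1∕h(4)² ≥ 11 would lie in the window
    have h4 : tent (3 * h 4 - 1 / 2) ≠ 0 := by
      intro h0
      have h10 : 1 / h 3 ^ 2 = 10 := by rw [hl, h0]; norm_num
      linarith
    obtain ⟨-, hhi4⟩ := hwin 4 h4
    have h11 : (11 : ℝ) ≤ 1 / h 4 ^ 2 := by
      rw [hlev 4]
      have := tau_le_one (h 5)
      push_cast
      linarith
    linarith
  -- conclusion
  funext m
  have hl := hlev m
  rw [hτ (m + 1) (by omega), sub_zero] at hl
  have e : h m = 1 / Real.sqrt (1 / h m ^ 2) := (one_div_sqrt_one_div_sq (hpos m)).symm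
  rw [e, hl]

/-- **ALONG A TRAJECTORY OF A FLOW WITH MEMORY, WELL-POSEDNESS OF RE-PINNING IS NOT MONOTONE IN THE SCALE.**  There are a functional B with a memory profile `(C_m, θ)` on a box
]0, γ] (0 < θ < 1) and an ASYMPTOTICALLY FREE box solution t of `MemFlow B p t` (`1∕t_a² + β*·m ≤ 1∕t(m)²`, β* > 0) such that (i) scale 0 is well posed — EVERY box solution
from the pin t(0) = p is t — and (ii) scale 1 is NOT: the flow re-pinned at t(1) has a box solution other than the tail `t(1 + ·)`.  Witness: `B u = 2 + tent(3u₀ − ½) −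
tent(3u₁ − ½)` (node U2's tent, one scale of memory), γ = p = t_a = ½, θ = ½, C_m = 120, β* = 2, `t(m) = (4 + 2m)^{−½}`, intruder `(6^{−½}, ⅓, 11^{−½}, …)`.  Contrast §44: for
Markov functionals (i) ⟹ well posed at EVERY scale. [folklore] -/
theorem wellPosed_not_monotone :
    ∃ (B : (ℕ → ℝ) → ℝ) (Cm θ γ bs ta p : ℝ) (t : ℕ → ℝ), MemoryProfile Cm θ γ B ∧ 0 ≤ Cm ∧ 0 < θ ∧ θ < 1 ∧ 0 < bs ∧ 0 < ta ∧
      SeqBox γ t ∧ MemFlow B p t ∧ (∀ m : ℕ, 1 / ta ^ 2 + bs * (m : ℝ) ≤ 1 / (t m) ^ 2) ∧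
      (∀ h : ℕ → ℝ, SeqBox γ h → MemFlow B (t 0) h → h = fun j => t (0 + j)) ∧
      ∃ f : ℕ → ℝ, SeqBox γ f ∧ MemFlow B (t 1) f ∧ f ≠ fun j => t (1 + j) := by
  refine ⟨fun u => 2 + tent (3 * u 0 - 1 / 2) - tent (3 * u 1 - 1 / 2), 60 / (1 / 2), 1 / 2, 1 / 2, 2, 1 / 2, 1 / 2,
    fun m : ℕ => 1 / Real.sqrt (4 + 2 * (m : ℝ)), memoryProfile_lagOneTent (by norm_num) (by norm_num), by norm_num, by norm_num, by norm_num, two_pos, by norm_num,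
    seqBox_slow, memFlow_slow, slow_profile, ?_, ?_⟩
  · intro h hh hf
    rw [memFlow_slow.1] at hf
    rw [unique_from_half hh hf]
    funext j
    show 1 / Real.sqrt (4 + 2 * (j : ℝ)) = 1 / Real.sqrt (4 + 2 * (((0 + j : ℕ)) : ℝ))
    rw [Nat.zero_add]
  · refine ⟨fun m : ℕ => 1 / Real.sqrt (if m = 0 then 6 else 7 + 2 * (m : ℝ)), seqBox_fast, ?_, fun h => fast_ne_tail ?_⟩
    · have h1 : (fun m : ℕ => 1 / Real.sqrt (4 + 2 * (m : ℝ))) 1 = 1 / Real.sqrt 6 := by norm_num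
      rw [h1]; exact memFlow_fast
    · rw [h]

/-- **… AND BY PART 25 THE SAME TRAJECTORY IS WELL POSED AGAIN FROM SOME SCALE ON**: for the witness of `wellPosed_not_monotone` there is n₀ ≥ 2 with every scale n ≥ n₀ well
posed — the well-posed scales of this asymptotically free trajectory contain 0 and `[n₀, ∞[` but not 1: co-finite, NOT an interval. [folklore] -/
theorem wellPosed_zero_not_one_eventually :
    ∃ (B : (ℕ → ℝ) → ℝ) (γ p : ℝ) (t : ℕ → ℝ), SeqBox γ t ∧ MemFlow B p t ∧
      (∀ h : ℕ → ℝ, SeqBox γ h → MemFlow B (t 0) h → h = fun j => t (0 + j)) ∧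
      (∃ f : ℕ → ℝ, SeqBox γ f ∧ MemFlow B (t 1) f ∧ f ≠ fun j => t (1 + j)) ∧
      ∃ n₀ : ℕ, 2 ≤ n₀ ∧ ∀ n, n₀ ≤ n → ∀ h : ℕ → ℝ, SeqBox γ h → MemFlow B (t n) h → h = fun j => t (n + j) := by
  obtain ⟨B, Cm, θ, γ, bs, ta, p, t, hB, hCm, hθ0, hθ1, hbs, hta, hts, htf, hprof, h0, f, hfs, hff, hne⟩ := wellPosed_not_monotone
  obtain ⟨n₀, hn₀⟩ := eventually_wellPosed_tail hB hCm hθ0.le hθ1 hbs hta hts htf hprof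
  refine ⟨B, γ, p, t, hts, htf, h0, ⟨f, hfs, hff, hne⟩, max n₀ 2, le_max_right _ _, fun n hn h hh hf => ?_⟩
  exact (hn₀ n ((le_max_left _ _).trans hn)).1 h hh hf

end

end Summit.QuantumFields.BalabanUV.Beta.EriceFlowEnclosureB12AsPrintedHistoryContagionShiftFlowRepinScales
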